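import Summits.ABC.IUTFork.Joshi.TestGenuinePinsVacuityResidual
import Summits.ABC.IUTFork.Joshi.TestGenuinePinsResidueDegreeOne
import Summits.ABC.IUTFork.Joshi.TestGenuinePinsVacuityRamified
import Summits.ABC.IUTFork.Thm311RealIsmDHMoverQuadraticFieldsDyadic
import HarnessLib

/-!
# Branch E TEST — the genuine-carrier pins are UNSATISFIABLE over EVERY quadratic field, over every `F ∋ √d` with
# `d ≡ 5 (mod 8)` (in particular every `F ∋ ζ_3`), and over every `F ∋ √d` with a prime `q ≥ 5`, `q ∥ d` — no `√−1` needed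

Proof-only sequel (abc-iut cell, D-0079 R-J «Joshi Y-discharge census», row Y-26 «residual class: F ramified inside {2,3} without √−1»;
seat abc-iut-E-t43, gen 4; 0 definitions, no `Prop` fact, FACT rows used: none) to abc-iut-E-t44's `Joshi/TestGenuinePinsVacuity{,Tame,
Ramified}.lean` (p445249 / p446217 / p446474) and this seat's `TestGenuinePinsVacuityResidual` / `TestGenuinePinsResidueDegreeOne`.
GLOBAL COROLLARIES of the per-place feeds — each a `¬ Cor312Vol.PinnedRegions` (/ `¬ PinnedRegions3`) theorem at abc-iut-c312-7's
`settingPrVolSharp` over `LatticeSituation.ofShells (logShellsDH X (analyticLogv F)) …` for the analytic logarithms and EVERY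
`X : PilotData F`, `ρ`, `qK`, column data, `Ψ`, ideles, column, with NO hypothesis naming a place (the place is found inside the proof:
abc-iut-c312-3's `placesOver_nonempty`):

* `not_pinnedRegions_settingPrVolSharp_of_mover_at` — bookkeeping form of p446217's criterion: ONE Dupuy–Hilado mover of the unit ball
  at ONE finite place `v₀ ∋ q` (the index `(thetaIndex X).over v₀ = q` is computed, not assumed);
* **`not_pinnedRegions(3)_settingPrVolSharp_of_sq_eq_five_mod_eight`** — every `F ∋ s` with `s² = d`, `d ≡ 5 (mod 8)`: at any place over
  `2` one has `f ≥ 2` (`two_le_inertiaDeg_of_sq_eq_five_mod_eight`), so the unramified-dyadic feed (`e = 1`) or the dyadic-complete feed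
  (`e ≥ 2`, `(e, f) ≠ (2, 1)`) applies; **`…_of_cube_root`** — in particular every `F` containing a primitive cube root of unity `ζ`
  (`(2ζ + 1)² = −3 ≡ 5`), e.g. every `F ⊇ ℚ(ζ_3)`, the field of Team R's GAP row G-c312-14-1;
* **`not_pinnedRegions(3)_settingPrVolSharp_of_sq_eq_of_prime_dvd`** — every `F ∋ s` with `s² = d`, `q ∣ d`, `q² ∤ d` for a prime `q ≥ 5`:
  `e(v|q) ≥ 2` at any `v ∣ q` (`‖√d‖ = q^{−1/2}`), so p446474's ramified-`p ≥ 5` feed applies with its ramification hypothesis DISCHARGED;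
* **`not_pinnedRegions(3)_settingPrVolSharp_of_quadratic`** — EVERY QUADRATIC FIELD: `[F : ℚ] = 2`, `F ∋ s`, `s² = d`, `d` squarefree,
  `d ≠ 1`; by `d mod 8`: `d ≡ 2 (mod 4)` / `d ≡ 7 (mod 8)` — abc-iut-w4-d017's dyadic movers (`Thm311RealIsmDHMoverQuadraticFieldsDyadic`);
  `d ≡ 5 (mod 8)` — the inert dyadic place; `d ≡ 1, 3 (mod 8)` — a prime `q ≥ 5` dividing `d`, or else `d = 3` and the `ℚ_3(√3)`-shaped place
  over `3` (`closedBall_one_ne_zpow_smul_logUnits_of_sq_eq_three`: `e = 2`, `f = 1`, no `ζ_3`, hence no fixed ball).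

CONSEQUENCE FOR THE RECORD (tree currency, no side taken): the genuine-carrier clauses «(ii)(b)@n ∧ (pΘ) ∧ (pq′) ⟹ ¬S» (p430714 /
p436213 / p438843, `PinnedRegions` as HYPOTHESIS at `settingPrVolSharp`) are VACUOUS at `logv = analyticLogv F` over every quadratic field
and over every field containing `ζ_3`, `√−1` (p446474), `√d` with `d ≡ 5 (mod 8)`, or `√d` with a prime `≥ 5` exactly dividing `d` — none
of which needs an initial Θ-datum.  What the kernel does NOT decide here: fields all of whose completions have `𝒪_v = p^k·log_p(𝒪_v^×)`
(the residual class of `TestGenuinePinsVacuityResidual`; by hand — local discriminant exponents and Minkowski's bound — that class is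
`{ℚ}`, NOT claimed in kernel).  HONEST SCOPE: OUR interface, OUR sharp real container, Dupuy–Hilado's reading of (Ind2); nothing here
bears on print's (xi-e)/(xi-f); locates / conditionally verifies; no abc claim. [claim: Mochizuki2012, status: disputed]
[cite: DupuyHilado2025, §4.9] [cite: NeukirchANT1999, Ch. II Prop. (5.3), (5.7), (6.8)]
-/

noncomputable section

open Set Function NumberField IsDedekindDomain Metric
open scoped Pointwise

namespace Summit.ABC.IUTFork.Joshi

open Thm311 Thm311.Real Cor312 Cor312Vol Literature.IUT.LogThetaLattice Literature.IUT.LogVolume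
  Literature.IUT.HodgeTheaters Literature.NumberTheory.NumberFields
open Literature.NumberTheory.GaloisRepresentations.Ultrametric GenuinePinsResidual

variable {F : Type} [Field F] [NumberField F] (X : PilotData F)
  (M : Type) [Field M] [NumberField M]
  (archPk : ∀ (j : (thetaIndex X).Label) (vQ : (thetaIndex X).VQ), Set ((logShellsDH X (analyticLogv F)).Packet j vQ))
  (archSub : ∀ (j : (thetaIndex X).Label) (v : (thetaIndex X).V),
    Set ((logShellsDH X (analyticLogv F)).Packet j ((thetaIndex X).over v)))
  (Ψ : ℤ → ∀ v : (thetaIndex X).V, v ∈ (thetaIndex X).Vbad → Set ((logShellsDH X (analyticLogv F)).StarPacket v))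
  (act : ℤ → ∀ v : (thetaIndex X).V, v ∈ (thetaIndex X).Vbad →
    (logShellsDH X (analyticLogv F)).StarPacket v → Module.End ℚ ((logShellsDH X (analyticLogv F)).StarPacket v))
  (Mmod : ℤ → ∀ j : (thetaIndex X).LabelStar, Set ((logShellsDH X (analyticLogv F)).GlobalPacket j.1))
  (region : ℤ → ∀ j : (thetaIndex X).LabelStar, FinDivisor M → ∀ vQ : (thetaIndex X).VQ,
    Set ((logShellsDH X (analyticLogv F)).Packet j.1 vQ))
  (frobAdm : ℤ → ℤ → ∀ (j : (thetaIndex X).Label) (vQ : (thetaIndex X).VQ),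
    Set ((logShellsDH X (analyticLogv F)).Packet j vQ) → Prop)
  (frobLogvol : ℤ → ℤ → ∀ (j : (thetaIndex X).Label) (vQ : (thetaIndex X).VQ),
    Set ((logShellsDH X (analyticLogv F)).Packet j vQ) → ℝ)
  (frobΨ : ℤ → ℤ → ∀ v : (thetaIndex X).V, v ∈ (thetaIndex X).Vbad → Set ((logShellsDH X (analyticLogv F)).StarPacket v))
  (frobMmod : ℤ → ℤ → ∀ j : (thetaIndex X).LabelStar, Set ((logShellsDH X (analyticLogv F)).GlobalPacket j.1))
  (unitImage : ℤ → ℤ → ℕ → ∀ (j : (thetaIndex X).Label) (vQ : (thetaIndex X).VQ),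
    Set ((logShellsDH X (analyticLogv F)).Packet j vQ))
  (ballImage : ℤ → ℤ → ∀ (j : (thetaIndex X).Label) (vQ : (thetaIndex X).VQ),
    Set ((logShellsDH X (analyticLogv F)).Packet j vQ))
  (thetaDiv : ℤ → ℤ → LgpDivisor M (thetaIndex X).lstar)
  (n : ℤ) {HT : Type} {LogLink : HT → HT → Type} {IsFull : ∀ {s t : HT}, LogLink s t → Prop}
  (lat : LGPGaussianLogThetaLattice LogLink IsFull)
  {Frd : Type} {IsoF : Frd → Frd → Type} {Ob : Frd → Type} {realify : Frd → Frd} {Strip : Type}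
  {IsoS : Strip → Strip → Type} {Mv : ∀ v : (thetaIndex X).V, v ∈ (thetaIndex X).Vbad → Type}
  [∀ v h, Monoid (Mv v h)]
  (sig : GlobalLGPFrobenioidSignature (thetaIndex X).lstar (thetaIndex X).V (· ∈ (thetaIndex X).Vbad)
    Frd IsoF Ob realify Strip IsoS Mv)
  (split : SplittingMonoids Mv) {ObΔ : Type} {N : ∀ v : (thetaIndex X).V, v ∈ (thetaIndex X).Vbad → Type}
  [∀ v h, Monoid (N v h)] (qData : QPilotData ObΔ N)
  (t : ∀ (pp : Nat.Primes) (_ : Fin X.lstar) (x : (thetaIndex X).Fibre (.inr pp)),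
    haveI : Fact (pp : ℕ).Prime := ⟨pp.2⟩; kOf X pp.1 x)
  (tq : ∀ (pp : Nat.Primes) (x : (thetaIndex X).Fibre (.inr pp)), haveI : Fact (pp : ℕ).Prime := ⟨pp.2⟩; kOf X pp.1 x)
  (ρ : (∀ v : (thetaIndex X).V, v ∈ (thetaIndex X).Vbad → Set ((logShellsDH X (analyticLogv F)).StarPacket v)) →
    ∀ (j : (thetaIndex X).Label) (vQ : (thetaIndex X).VQ), Set ((logShellsDH X (analyticLogv F)).Packet j vQ))
  (qK : ∀ v : (thetaIndex X).V, v ∈ (thetaIndex X).Vbad → Set ((logShellsDH X (analyticLogv F)).StarPacket v))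
  (htq0 : ∀ pp x, tq pp x ≠ 0)
  (htq1 : ∀ (pp : Nat.Primes) (x : (thetaIndex X).Fibre (.inr pp)),
    haveI : Fact (pp : ℕ).Prime := ⟨pp.2⟩; placeOf X pp.1 x ∉ X.S → ‖tq pp x‖ = 1)

/-! ## 1. Bookkeeping: one mover at one place `v₀ ∋ q` -/

/-- **ONE MOVER OF THE UNIT BALL AT ONE PLACE `v₀ ∋ q` ⇒ `PinnedRegions` FAILS at `settingPrVolSharp`** — p446217's criterion with the
index `(thetaIndex X).over v₀` computed from `q ∈ v₀` (abc-iut-c312-3's `residueChar`) and the mover read in abc-iut-w5-d180's currency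
(`toR`/`ofR` on the rescaled completion; abc-iut-w5-d044's dictionary). [cite: DupuyHilado2025, §4.9] [claim: Mochizuki2012, status: disputed] -/
theorem not_pinnedRegions_settingPrVolSharp_of_mover_at (q : ℕ) [hq : Fact q.Prime] (v₀ : HeightOneSpectrum (𝓞 F))
    (hv : ((q : ℕ) : 𝓞 F) ∈ v₀.asIdeal)
    (hmov : ∃ g ∈ ismDH (analyticLogv F) (.inr v₀ : Thm311.Real.Place F),
      (fun a => toR q v₀ hv (g (ofR q v₀ hv a))) '' closedBall (0 : RescaledCompletion F q v₀ hv) 1 ≠ closedBall 0 1) :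
    ¬ Cor312Vol.PinnedRegions
      (LatticeSituation.ofShells (logShellsDH X (analyticLogv F)) M archPk archSub
        (summandPiecesPr X (logvAnalytic_analyticLogv (F := F))).Adm
        (summandPiecesPr X (logvAnalytic_analyticLogv (F := F))).logvol Ψ act Mmod region frobAdm frobLogvol frobΨ frobMmod
        unitImage ballImage thetaDiv)
      (settingPrVolSharp X (logvAnalytic_analyticLogv (F := F)) M archPk archSub Ψ act Mmod region n lat sig split qData tq t
        htq0 htq1) ρ qK := by
  have hres : residueChar F v₀ = q :=
    (mem_placesOver_iff_residueChar v₀).mp ((mem_placesOver_iff v₀).mpr (liesOver_span_of_natCast_mem F q v₀ hv))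
  have hv₀ : (thetaIndex X).over (.inr v₀) = .inr ⟨q, hq.out⟩ := by
    rw [over_inr_eq]; exact congrArg Sum.inr (Subtype.ext hres)
  exact not_pinnedRegions_settingPrVolSharp_of_exists_mover_anyPrime X M archPk archSub Ψ act Mmod region frobAdm frobLogvol frobΨ
          frobMmod unitImage ballImage thetaDiv n lat sig split qData t tq ρ qK htq0 htq1 ⟨q, hq.out⟩ v₀ hv₀
    (exists_ismDH_image_integers_ne_of_image_closedBall_ne ⟨q, hq.out⟩ v₀ hv hmov)

/-! ## 2. `F ∋ √d`, `d ≡ 5 (mod 8)` — in particular `F ∋ ζ_3` -/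

/-- **EVERY `F ∋ s` WITH `s² = d`, `d ≡ 5 (mod 8)`: `PinnedRegions` FAILS at `settingPrVolSharp`** (analytic logarithms; every
`X : PilotData F`, `ρ`, `qK`, column data, `Ψ`, ideles, column): at a place `v₀ ∣ 2` one has `f(v₀|2) ≥ 2`, so Dupuy–Hilado's (Ind2) moves
`𝒪_{v₀}` — by abc-iut-w5-d180's unramified-dyadic mover if `e(v₀|2) = 1`, by abc-iut-c312-5's complete dyadic column if `e(v₀|2) ≥ 2`.
[cite: DupuyHilado2025, §4.9] [cite: NeukirchANT1999, Ch. II Prop. (5.3)] [claim: Mochizuki2012, status: disputed] -/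
theorem not_pinnedRegions_settingPrVolSharp_of_sq_eq_five_mod_eight {s : F} {d : ℤ} (hs : s ^ 2 = d) (hd : d % 8 = 5) :
    ¬ Cor312Vol.PinnedRegions
      (LatticeSituation.ofShells (logShellsDH X (analyticLogv F)) M archPk archSub
        (summandPiecesPr X (logvAnalytic_analyticLogv (F := F))).Adm
        (summandPiecesPr X (logvAnalytic_analyticLogv (F := F))).logvol Ψ act Mmod region frobAdm frobLogvol frobΨ frobMmod
        unitImage ballImage thetaDiv)
      (settingPrVolSharp X (logvAnalytic_analyticLogv (F := F)) M archPk archSub Ψ act Mmod region n lat sig split qData tq t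
        htq0 htq1) ρ qK := by
  haveI : Fact (Nat.Prime 2) := ⟨Nat.prime_two⟩
  obtain ⟨v₀, hv₀mem⟩ := placesOver_nonempty F 2
  have hres : residueChar F v₀ = 2 := (mem_placesOver_iff_residueChar v₀).mp hv₀mem
  have hv₀ : (thetaIndex X).over (.inr v₀) = .inr ⟨2, Nat.prime_two⟩ := by
    rw [over_inr_eq]; exact congrArg Sum.inr (Subtype.ext hres)
  have hv : ((2 : ℕ) : 𝓞 F) ∈ v₀.asIdeal := natCast_mem_placeOf X (⟨2, Nat.prime_two⟩ : Nat.Primes) ⟨.inr v₀, hv₀⟩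
  have hf : 2 ≤ v₀.asIdeal.inertiaDeg ℤ := two_le_inertiaDeg_of_sq_eq_five_mod_eight 2 v₀ hv rfl hs hd
  have he1 : 1 ≤ v₀.asIdeal.ramificationIdx ℤ := Ideal.ramificationIdx_pos _ _
  rcases he1.eq_or_lt with he | he
  · exact not_pinnedRegions_settingPrVolSharp_of_unramified_dyadic_anyPrime X M archPk archSub Ψ act Mmod region frobAdm frobLogvol frobΨ
          frobMmod unitImage ballImage thetaDiv n lat sig split qData t tq ρ qK htq0 htq1 v₀ hv₀ he.symm hf
  · exact not_pinnedRegions_settingPrVolSharp_of_dyadic_complete_anyPrime X M archPk archSub Ψ act Mmod region frobAdm frobLogvol frobΨ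
          frobMmod unitImage ballImage thetaDiv n lat sig split qData t tq ρ qK htq0 htq1 v₀ hv₀ he (by omega)

/-- The same for `PinnedRegions3`. [claim: Mochizuki2012, status: disputed] -/
theorem not_pinnedRegions3_settingPrVolSharp_of_sq_eq_five_mod_eight {s : F} {d : ℤ} (hs : s ^ 2 = d) (hd : d % 8 = 5) :
    ¬ Cor312Vol.PinnedRegions3
      (LatticeSituation.ofShells (logShellsDH X (analyticLogv F)) M archPk archSub
        (summandPiecesPr X (logvAnalytic_analyticLogv (F := F))).Adm
        (summandPiecesPr X (logvAnalytic_analyticLogv (F := F))).logvol Ψ act Mmod region frobAdm frobLogvol frobΨ frobMmod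
        unitImage ballImage thetaDiv)
      (settingPrVolSharp X (logvAnalytic_analyticLogv (F := F)) M archPk archSub Ψ act Mmod region n lat sig split qData tq t
        htq0 htq1) ρ qK :=
  fun h => not_pinnedRegions_settingPrVolSharp_of_sq_eq_five_mod_eight X M archPk archSub Ψ act Mmod region frobAdm frobLogvol frobΨ
          frobMmod unitImage ballImage thetaDiv n lat sig split qData t tq ρ qK htq0 htq1 hs hd h.1

/-- **EVERY `F` CONTAINING A PRIMITIVE CUBE ROOT OF UNITY `ζ`** (`ζ² + ζ + 1 = 0`; e.g. `F ⊇ ℚ(ζ_3)`, the field of GAP row G-c312-14-1):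
**`PinnedRegions` FAILS at `settingPrVolSharp`** — `(2ζ + 1)² = −3 ≡ 5 (mod 8)`. [cite: DupuyHilado2025, §4.9]
[cite: NeukirchANT1999, Ch. I (10.3)] [claim: Mochizuki2012, status: disputed] -/
theorem not_pinnedRegions_settingPrVolSharp_of_cube_root {ζ : F} (hζ : ζ ^ 2 + ζ + 1 = 0) :
    ¬ Cor312Vol.PinnedRegions
      (LatticeSituation.ofShells (logShellsDH X (analyticLogv F)) M archPk archSub
        (summandPiecesPr X (logvAnalytic_analyticLogv (F := F))).Adm
        (summandPiecesPr X (logvAnalytic_analyticLogv (F := F))).logvol Ψ act Mmod region frobAdm frobLogvol frobΨ frobMmod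
        unitImage ballImage thetaDiv)
      (settingPrVolSharp X (logvAnalytic_analyticLogv (F := F)) M archPk archSub Ψ act Mmod region n lat sig split qData tq t
        htq0 htq1) ρ qK :=
  not_pinnedRegions_settingPrVolSharp_of_sq_eq_five_mod_eight X M archPk archSub Ψ act Mmod region frobAdm frobLogvol frobΨ
          frobMmod unitImage ballImage thetaDiv n lat sig split qData t tq ρ qK htq0 htq1
    (s := 2 * ζ + 1) (d := -3) (by push_cast; linear_combination (4 : F) * hζ) (by decide)

/-- The same for `PinnedRegions3`. [claim: Mochizuki2012, status: disputed] -/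
theorem not_pinnedRegions3_settingPrVolSharp_of_cube_root {ζ : F} (hζ : ζ ^ 2 + ζ + 1 = 0) :
    ¬ Cor312Vol.PinnedRegions3
      (LatticeSituation.ofShells (logShellsDH X (analyticLogv F)) M archPk archSub
        (summandPiecesPr X (logvAnalytic_analyticLogv (F := F))).Adm
        (summandPiecesPr X (logvAnalytic_analyticLogv (F := F))).logvol Ψ act Mmod region frobAdm frobLogvol frobΨ frobMmod
        unitImage ballImage thetaDiv)
      (settingPrVolSharp X (logvAnalytic_analyticLogv (F := F)) M archPk archSub Ψ act Mmod region n lat sig split qData tq t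
        htq0 htq1) ρ qK :=
  fun h => not_pinnedRegions_settingPrVolSharp_of_cube_root X M archPk archSub Ψ act Mmod region frobAdm frobLogvol frobΨ
          frobMmod unitImage ballImage thetaDiv n lat sig split qData t tq ρ qK htq0 htq1 hζ h.1

/-! ## 3. `F ∋ √d` with a prime `q ≥ 5` exactly dividing `d` -/

/-- **EVERY `F ∋ s` WITH `s² = d`, `q ∣ d`, `q² ∤ d` FOR A PRIME `q ≥ 5`: `PinnedRegions` FAILS at `settingPrVolSharp`** — `‖√d‖_v = q^{−1/2}`
forces `e(v|q) ≥ 2` at any `v ∣ q`, where abc-iut-w5-d039's census has a mover (p446474's feed, ramification hypothesis discharged).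
[cite: DupuyHilado2025, §4.9] [cite: NeukirchANT1999, Ch. II Prop. (6.8)] [claim: Mochizuki2012, status: disputed] -/
theorem not_pinnedRegions_settingPrVolSharp_of_sq_eq_of_prime_dvd (q : ℕ) (hq : q.Prime) (h5 : 5 ≤ q) {s : F} {d : ℤ}
    (hs : s ^ 2 = d) (h1 : (q : ℤ) ∣ d) (h2 : ¬ (q : ℤ) ^ 2 ∣ d) :
    ¬ Cor312Vol.PinnedRegions
      (LatticeSituation.ofShells (logShellsDH X (analyticLogv F)) M archPk archSub
        (summandPiecesPr X (logvAnalytic_analyticLogv (F := F))).Adm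
        (summandPiecesPr X (logvAnalytic_analyticLogv (F := F))).logvol Ψ act Mmod region frobAdm frobLogvol frobΨ frobMmod
        unitImage ballImage thetaDiv)
      (settingPrVolSharp X (logvAnalytic_analyticLogv (F := F)) M archPk archSub Ψ act Mmod region n lat sig split qData tq t
        htq0 htq1) ρ qK := by
  haveI : Fact q.Prime := ⟨hq⟩
  obtain ⟨v₀, hv₀mem⟩ := placesOver_nonempty F q
  have hres : residueChar F v₀ = q := (mem_placesOver_iff_residueChar v₀).mp hv₀mem
  have hv₀ : (thetaIndex X).over (.inr v₀) = .inr ⟨q, hq⟩ := by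
    rw [over_inr_eq]; exact congrArg Sum.inr (Subtype.ext hres)
  have hv : ((q : ℕ) : 𝓞 F) ∈ v₀.asIdeal := natCast_mem_placeOf X (⟨q, hq⟩ : Nat.Primes) ⟨.inr v₀, hv₀⟩
  exact not_pinnedRegions_settingPrVolSharp_of_ramified_five_le_anyPrime X M archPk archSub Ψ act Mmod region frobAdm frobLogvol frobΨ
          frobMmod unitImage ballImage thetaDiv n lat sig split qData t tq ρ qK htq0 htq1 ⟨q, hq⟩ h5 v₀ hv₀
    (two_le_ramificationIdx_of_sq_eq_of_dvd q v₀ hv hs h1 h2)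

/-- The same for `PinnedRegions3`. [claim: Mochizuki2012, status: disputed] -/
theorem not_pinnedRegions3_settingPrVolSharp_of_sq_eq_of_prime_dvd (q : ℕ) (hq : q.Prime) (h5 : 5 ≤ q) {s : F} {d : ℤ}
    (hs : s ^ 2 = d) (h1 : (q : ℤ) ∣ d) (h2 : ¬ (q : ℤ) ^ 2 ∣ d) :
    ¬ Cor312Vol.PinnedRegions3
      (LatticeSituation.ofShells (logShellsDH X (analyticLogv F)) M archPk archSub
        (summandPiecesPr X (logvAnalytic_analyticLogv (F := F))).Adm
        (summandPiecesPr X (logvAnalytic_analyticLogv (F := F))).logvol Ψ act Mmod region frobAdm frobLogvol frobΨ frobMmod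
        unitImage ballImage thetaDiv)
      (settingPrVolSharp X (logvAnalytic_analyticLogv (F := F)) M archPk archSub Ψ act Mmod region n lat sig split qData tq t
        htq0 htq1) ρ qK :=
  fun h => not_pinnedRegions_settingPrVolSharp_of_sq_eq_of_prime_dvd X M archPk archSub Ψ act Mmod region frobAdm frobLogvol frobΨ
          frobMmod unitImage ballImage thetaDiv n lat sig split qData t tq ρ qK htq0 htq1 q hq h5 hs h1 h2 h.1

/-! ## 4. Every quadratic field -/

/-- **EVERY QUADRATIC FIELD `ℚ(√d)`** (`[F : ℚ] = 2`, `F ∋ s`, `s² = d`, `d` a squarefree integer `≠ 1`): **`PinnedRegions` FAILS at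
`settingPrVolSharp`** for the analytic logarithms — every `X : PilotData F`, `ρ`, `qK`, column data, `Ψ`, ideles, column.  By `d mod 8`:
`2 (mod 4)` and `7 (mod 8)` — the dyadic place (abc-iut-w4-d017); `5 (mod 8)` — the inert dyadic place; `1, 3 (mod 8)` — a ramified place over a
prime `q ≥ 5` dividing `d`, or `d = 3` and the `ℚ_3(√3)`-shaped place. [cite: DupuyHilado2025, §4.9]
[cite: NeukirchANT1999, Ch. II Prop. (5.3), (5.7), (6.8)] [claim: Mochizuki2012, status: disputed] -/
theorem not_pinnedRegions_settingPrVolSharp_of_quadratic (hF : Module.finrank ℚ F = 2) {s : F} {d : ℤ} (hs : s ^ 2 = d)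
    (hsq : Squarefree d) (hd1 : d ≠ 1) :
    ¬ Cor312Vol.PinnedRegions
      (LatticeSituation.ofShells (logShellsDH X (analyticLogv F)) M archPk archSub
        (summandPiecesPr X (logvAnalytic_analyticLogv (F := F))).Adm
        (summandPiecesPr X (logvAnalytic_analyticLogv (F := F))).logvol Ψ act Mmod region frobAdm frobLogvol frobΨ frobMmod
        unitImage ballImage thetaDiv)
      (settingPrVolSharp X (logvAnalytic_analyticLogv (F := F)) M archPk archSub Ψ act Mmod region n lat sig split qData tq t
        htq0 htq1) ρ qK := by
  -- squarefree: no square of a non-unit divides `d`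
  have hnsq : ∀ m : ℤ, m ≠ 1 → m ≠ -1 → ¬ m * m ∣ d := fun m h1 h2 hdvd =>
    by rcases Int.isUnit_iff.mp (hsq m hdvd) with h | h <;> [exact h1 h; exact h2 h]
  have h4 : ¬ (4 : ℤ) ∣ d := fun h => hnsq 2 (by decide) (by decide) (by simpa using h)
  -- a prime `q ≥ 5` exactly dividing `d` settles the matter
  have hbig : ∀ q : ℕ, q.Prime → q ≠ 2 → q ≠ 3 → (q : ℤ) ∣ d →
    ¬ Cor312Vol.PinnedRegions
      (LatticeSituation.ofShells (logShellsDH X (analyticLogv F)) M archPk archSub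
        (summandPiecesPr X (logvAnalytic_analyticLogv (F := F))).Adm
        (summandPiecesPr X (logvAnalytic_analyticLogv (F := F))).logvol Ψ act Mmod region frobAdm frobLogvol frobΨ frobMmod
        unitImage ballImage thetaDiv)
      (settingPrVolSharp X (logvAnalytic_analyticLogv (F := F)) M archPk archSub Ψ act Mmod region n lat sig split qData tq t
        htq0 htq1) ρ qK := by
    intro q hq hq2 hq3 hqd
    have hq4 : q ≠ 4 := fun h => by rw [h] at hq; exact absurd hq (by decide)
    have h5 : 5 ≤ q := by have := hq.two_le; omega
    refine not_pinnedRegions_settingPrVolSharp_of_sq_eq_of_prime_dvd X M archPk archSub Ψ act Mmod region frobAdm frobLogvol frobΨ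
          frobMmod unitImage ballImage thetaDiv n lat sig split qData t tq ρ qK htq0 htq1 q hq h5 hs hqd fun h => ?_
    rw [sq] at h
    exact hnsq q (by exact_mod_cast hq.one_lt.ne') (by have := hq.two_le; omega) h
  haveI : Fact (Nat.Prime 2) := ⟨Nat.prime_two⟩
  -- the dyadic place
  obtain ⟨v₂, hv₂mem⟩ := placesOver_nonempty F 2
  have hv₂ : ((2 : ℕ) : 𝓞 F) ∈ v₂.asIdeal := by
    have := (mem_placesOver_iff v₂).mp hv₂mem
    simpa using Ideal.mem_comap.mp (show ((2 : ℕ) : ℤ) ∈ v₂.asIdeal.under ℤ by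
      rw [← this.over]; exact Ideal.mem_span_singleton_self _)
  rcases (by omega : d % 4 = 2 ∨ d % 8 = 7 ∨ d % 8 = 5 ∨ (d % 2 = 1 ∧ d % 8 ≠ 5 ∧ d % 8 ≠ 7)) with h | h | h | h
  · -- `d ≡ 2 (mod 4)`: every ball at the dyadic place is moved
    have hmov := exists_mem_ismDH_image_closedBall_ne_of_two_mod_four (logvAnalyticAt_analyticLogv (F := F) 2) v₂ hv₂ hF hs h
      (one_ne_zero : (1 : RescaledCompletion F 2 v₂ hv₂) ≠ 0)
    rw [norm_one] at hmov
    exact not_pinnedRegions_settingPrVolSharp_of_mover_at X M archPk archSub Ψ act Mmod region frobAdm frobLogvol frobΨ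
          frobMmod unitImage ballImage thetaDiv n lat sig split qData t tq ρ qK htq0 htq1 2 v₂ hv₂ hmov
  · -- `d ≡ 7 (mod 8)`: the unit ball at the dyadic place is moved
    exact not_pinnedRegions_settingPrVolSharp_of_mover_at X M archPk archSub Ψ act Mmod region frobAdm frobLogvol frobΨ
          frobMmod unitImage ballImage thetaDiv n lat sig split qData t tq ρ qK htq0 htq1 2 v₂ hv₂
      (exists_mem_ismDH_image_closedBall_one_ne_of_seven_mod_eight' (logvAnalyticAt_analyticLogv (F := F) 2) v₂ hv₂ hF hs h)
  · -- `d ≡ 5 (mod 8)`: the inert dyadic place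
    exact not_pinnedRegions_settingPrVolSharp_of_sq_eq_five_mod_eight X M archPk archSub Ψ act Mmod region frobAdm frobLogvol frobΨ
          frobMmod unitImage ballImage thetaDiv n lat sig split qData t tq ρ qK htq0 htq1 hs h
  · -- `d` odd, `d ≢ 5, 7 (mod 8)`: an odd prime `q ≠ 3` divides `d`, or `d = 3`
    obtain ⟨hodd, h5', h7'⟩ := h
    by_cases h3 : (3 : ℤ) ∣ d
    · obtain ⟨m, hm⟩ := h3
      have h3m : ¬ (3 : ℤ) ∣ m := fun ⟨k, hk⟩ => hnsq 3 (by decide) (by decide) ⟨k, by rw [hm, hk]; ring⟩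
      by_cases hm1 : m.natAbs = 1
      · -- `d = ±3`, and `d ≢ 5 (mod 8)` leaves `d = 3`: the `ℚ_3(√3)`-shaped place over `3`
        have hd3 : d = 3 := by rcases Int.natAbs_eq m with h' | h' <;> rw [hm1] at h' <;> omega
        subst hd3
        haveI : Fact (Nat.Prime 3) := ⟨Nat.prime_three⟩
        obtain ⟨v₃, hv₃mem⟩ := placesOver_nonempty F 3
        have hres : residueChar F v₃ = 3 := (mem_placesOver_iff_residueChar v₃).mp hv₃mem
        have hv₃' : (thetaIndex X).over (.inr v₃) = .inr ⟨3, Nat.prime_three⟩ := by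
          rw [over_inr_eq]; exact congrArg Sum.inr (Subtype.ext hres)
        have hv₃ : ((3 : ℕ) : 𝓞 F) ∈ v₃.asIdeal := natCast_mem_placeOf X (⟨3, Nat.prime_three⟩ : Nat.Primes) ⟨.inr v₃, hv₃'⟩
        exact not_pinnedRegions_settingPrVolSharp_of_forall_ne_anyPrime X M archPk archSub Ψ act Mmod region frobAdm frobLogvol frobΨ
          frobMmod unitImage ballImage thetaDiv n lat sig split qData t tq ρ qK htq0 htq1 ⟨3, Nat.prime_three⟩ v₃ hv₃' hv₃
          (closedBall_one_ne_zpow_smul_logUnits_of_sq_eq_three 3 v₃ hv₃ rfl hF hs)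
      · obtain ⟨q, hq, hqm⟩ := Nat.exists_prime_and_dvd hm1
        have hqm' : (q : ℤ) ∣ m := Int.natCast_dvd.mpr hqm
        have hqd : (q : ℤ) ∣ d := hqm'.trans ⟨3, by rw [hm]; ring⟩
        refine hbig q hq ?_ ?_ hqd
        · rintro rfl; obtain ⟨k, hk⟩ := hqd; omega
        · rintro rfl; exact h3m hqm'
    · have hd1' : d.natAbs ≠ 1 := fun h' => by rcases Int.natAbs_eq d with h'' | h'' <;> rw [h'] at h'' <;> omega
      obtain ⟨q, hq, hqd⟩ := Nat.exists_prime_and_dvd hd1'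
      have hqd' : (q : ℤ) ∣ d := Int.natCast_dvd.mpr hqd
      refine hbig q hq ?_ ?_ hqd'
      · rintro rfl; obtain ⟨k, hk⟩ := hqd'; omega
      · rintro rfl; exact h3 hqd'

/-- The same for `PinnedRegions3`. [claim: Mochizuki2012, status: disputed] -/
theorem not_pinnedRegions3_settingPrVolSharp_of_quadratic (hF : Module.finrank ℚ F = 2) {s : F} {d : ℤ} (hs : s ^ 2 = d)
    (hsq : Squarefree d) (hd1 : d ≠ 1) :
    ¬ Cor312Vol.PinnedRegions3
      (LatticeSituation.ofShells (logShellsDH X (analyticLogv F)) M archPk archSub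
        (summandPiecesPr X (logvAnalytic_analyticLogv (F := F))).Adm
        (summandPiecesPr X (logvAnalytic_analyticLogv (F := F))).logvol Ψ act Mmod region frobAdm frobLogvol frobΨ frobMmod
        unitImage ballImage thetaDiv)
      (settingPrVolSharp X (logvAnalytic_analyticLogv (F := F)) M archPk archSub Ψ act Mmod region n lat sig split qData tq t
        htq0 htq1) ρ qK :=
  fun h => not_pinnedRegions_settingPrVolSharp_of_quadratic X M archPk archSub Ψ act Mmod region frobAdm frobLogvol frobΨ
          frobMmod unitImage ballImage thetaDiv n lat sig split qData t tq ρ qK htq0 htq1 hF hs hsq hd1 h.1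

end Summit.ABC.IUTFork.Joshi

end
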